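import Summits.CriticalPhenomena.PercolationContinuityZ3.Theorems.PercNearOneGluingNoHeavyLowerTailTwoCopyFastCheck
import Summits.CriticalPhenomena.PercolationContinuityZ3.Theorems.PercNearOneGluingNoHeavyLowerTailOneCutCertSound
import HarnessLib

/-!
# Two-copy certificates: a KRONECKER (big-integer) fibre checker for `TwoCopy.twoCopyCheck`

builds on p205010 (kernel theorem, internal audit signed; external expert review pending)

Support file (`--supports stmt-CriticalPhenomena-4575`), seat `prim-cert-1` (gen 18).  The fibre-enumerating checkers
`TwoCopy.twoCopyCheck` / `twoCopyCheckFast` (`…TwoCopyFibre`, `…TwoCopyFastCheck`) cost `O(4^m)` INTERPRETED steps — fine up to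
`m = 11`, too slow for the sun graphs with `K = 6, 7` hairs (`m = 13, 15`).  prim-cert-2's box-certificate checker (`OneCutCert.boxCheck`,
`…OneCutCertCheck/Sound`) reads ALL `3^m` fibre sums off ONE big integer `Z = Σ_p KR(a_p)·KR(t_p) − KR(b)·KR(h)` (Kronecker numbers in
base `2^s`, fast construction `OneCutCert.krN/krZ`, digit test by one `AND` with a mask), so that `native_decide` spends its time in GMP.
This file transplants that check to the mask-indexed two-copy world and proves it implies `twoCopyCheck`:

* `TwoCopy.dec2` / `OneCutCert.enc2` — masks `c < 2^m` ↔ corners `Fin m → Bool`;  `TwoCopy.kOf` — the key `(S₂, S₁)` as a map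
  `Fin m → Fin 3`, with `OneCutCert.key g h = kOf (enc2 h &&& enc2 g) (enc2 h ^^^ enc2 g)`;
* `TwoCopy.sum_fibre_eq_fibZ` — integer version of `TwoCopy.sum_fibre_eq_fib`;
* `TwoCopy.pcoef_enc2_eq_fib` — **prim-cert-2's fibre sum `pcoef` of corner tables read through `enc2` is `TwoCopy.fib`**;
* `TwoCopy.twoCopyKronCheck m K s tL hL aL bL` — the check on list tables (targets `tL`, hypothesis `hL`, multipliers `aL, bL`, all of
  length `2^m`, little-endian mask order) and `TwoCopy.twoCopyCheck_of_kronCheck` — **if it passes then `twoCopyCheck` passes** for the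
  table functions `fun p c => (tL.getD p []).getD c 0`, etc.
No sorries; standard axioms; nothing here asserts anything about the crux.
-/

namespace Summit.CriticalPhenomena.PercolationContinuityZ3.Theorems.TwoCopy

open Finset
open Summit.CriticalPhenomena.PercolationContinuityZ3.Theorems.OneCutCert

/-! ## Masks and corners -/

/-- The corner of a mask: coordinate `i` is bit `i`. [this work] -/
def dec2 (m : ℕ) (c : ℕ) : Fin m → Bool := fun i => c.testBit i

/-- `enc2 (dec2 c) = c` below `2^m`. [this work] -/
theorem enc2_dec2 {m c : ℕ} (hc : c < 2 ^ m) : enc2 (dec2 m c) = c := by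
  refine Nat.eq_of_testBit_eq fun i => ?_
  by_cases hi : i < m
  · rw [testBit_enc2 _ ⟨i, hi⟩]; rfl
  · rw [testBit_enc2_of_le _ i (not_lt.1 hi),
      Nat.testBit_lt_two_pow (lt_of_lt_of_le hc (Nat.pow_le_pow_right (by norm_num) (not_lt.1 hi)))]

/-- `dec2 (enc2 g) = g`. [this work] -/
theorem dec2_enc2 {m : ℕ} (g : Fin m → Bool) : dec2 m (enc2 g) = g := by
  funext i; exact testBit_enc2 g i

/-- The key `(S₂, S₁)` as a digit map: `2` on `S₂`, `1` on `S₁`, `0` elsewhere. [this work] -/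
def kOf (m : ℕ) (S2 S1 : ℕ) : Fin m → Fin 3 := fun i => if S2.testBit i then 2 else if S1.testBit i then 1 else 0

/-- prim-cert-2's corner key is `kOf` of the mask key. [this work] -/
theorem key_eq_kOf {m : ℕ} (g h : Fin m → Bool) :
    OneCutCert.key g h = kOf m (enc2 h &&& enc2 g) (enc2 h ^^^ enc2 g) := by
  funext i
  unfold OneCutCert.key kOf
  rw [Nat.testBit_and, Nat.testBit_xor, testBit_enc2, testBit_enc2]
  cases g i <;> cases h i <;> rfl

/-- `kOf` determines a disjoint pair of masks below `2^m`. [this work] -/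
theorem kOf_inj {m A B S2 S1 : ℕ} (hA : A < 2 ^ m) (hB : B < 2 ^ m) (hAB : A &&& B = 0)
    (hS2 : S2 < 2 ^ m) (hS1 : S1 < 2 ^ m) (hd : S2 &&& S1 = 0) (h : kOf m A B = kOf m S2 S1) : A = S2 ∧ B = S1 := by
  have hAB' : ∀ i, (A.testBit i && B.testBit i) = false := fun i => by
    have := congrArg (fun n => n.testBit i) hAB; simpa [Nat.testBit_and] using this
  have hd' : ∀ i, (S2.testBit i && S1.testBit i) = false := fun i => by
    have := congrArg (fun n => n.testBit i) hd; simpa [Nat.testBit_and] using this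
  have hlt : ∀ {x : ℕ}, x < 2 ^ m → ∀ i, m ≤ i → x.testBit i = false := fun hx i hi =>
    Nat.testBit_lt_two_pow (lt_of_lt_of_le hx (Nat.pow_le_pow_right (by norm_num) hi))
  have key : ∀ i, i < m → A.testBit i = S2.testBit i ∧ B.testBit i = S1.testBit i := by
    intro i hi
    have h1 := congrFun h ⟨i, hi⟩
    unfold kOf at h1
    dsimp only at h1
    have e1 := hAB' i; have e2 := hd' i
    cases hA2 : A.testBit i <;> cases hB2 : B.testBit i <;> cases hS22 : S2.testBit i <;> cases hS12 : S1.testBit i <;>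
      simp_all
  constructor
  · refine Nat.eq_of_testBit_eq fun i => ?_
    by_cases hi : i < m
    · exact (key i hi).1
    · rw [hlt hA i (not_lt.1 hi), hlt hS2 i (not_lt.1 hi)]
  · refine Nat.eq_of_testBit_eq fun i => ?_
    by_cases hi : i < m
    · exact (key i hi).2
    · rw [hlt hB i (not_lt.1 hi), hlt hS1 i (not_lt.1 hi)]

/-! ## Fibre sums: integer version and the bridge to `pcoef` -/

/-- Integer version of `sum_fibre_eq_fib`: on a fibre `(S₂, S₁)` the sum over pairs is the `T ⊆ S₁` sum. [this work] -/
theorem sum_fibre_eq_fibZ (m : ℕ) (G : ℕ → ℕ → ℤ) {S2 S1 : ℕ} (hS2 : S2 < 2 ^ m) (hS1 : S1 < 2 ^ m)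
    (hd : S2 &&& S1 = 0) :
    ∑ x ∈ (range (2 ^ m) ×ˢ range (2 ^ m)).filter (fun x => key x = (S2, S1)), G x.1 x.2 = fib m G S2 S1 := by
  unfold fib
  symm
  refine sum_bij' (fun T _ => param S2 S1 T) (fun x _ => unparam x) ?_ ?_ ?_ ?_ ?_
  · intro T hT
    rw [mem_filter, mem_range] at hT
    rw [mem_filter, mem_product, mem_range, mem_range, key_param hd hT.2]
    refine ⟨⟨or_lt_two_pow hS2 hT.1, or_lt_two_pow hS2 (xor_lt_two_pow hS1 hT.1)⟩, rfl⟩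
  · intro x hx
    rw [mem_filter, mem_product, mem_range, mem_range] at hx
    rw [mem_filter, mem_range]
    refine ⟨?_, unparam_and hx.2⟩
    unfold unparam
    exact and_lt_two_pow hx.1.1
  · intro T hT
    rw [mem_filter] at hT
    exact unparam_param hd hT.2
  · intro x hx
    rw [mem_filter] at hx
    exact param_unparam hx.2
  · intro T hT
    rfl

/-- **prim-cert-2's fibre sum through `enc2` is `TwoCopy.fib`.**  For tables `A` (multiplier) and `B` (target) on masks and a fibre
`(S₂, S₁)`: `pcoef (A ∘ enc2) (B ∘ enc2) (kOf S₂ S₁) = fib m (fun c₁ c₂ => B c₁ * A c₂) S₂ S₁`. [this work] -/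
theorem pcoef_enc2_eq_fib (m : ℕ) (A B : ℕ → ℤ) {S2 S1 : ℕ} (hS2 : S2 < 2 ^ m) (hS1 : S1 < 2 ^ m) (hd : S2 &&& S1 = 0) :
    pcoef (fun g : Fin m → Bool => A (enc2 g)) (fun h => B (enc2 h)) (kOf m S2 S1) = fib m (fun c1 c2 => B c1 * A c2) S2 S1 := by
  classical
  rw [← sum_fibre_eq_fibZ m _ hS2 hS1 hd, sum_filter]
  unfold pcoef
  rw [← Finset.sum_product']
  -- reindex `(g, h) ↦ (enc2 h, enc2 g)`
  refine sum_bij' (fun gh _ => (enc2 gh.2, enc2 gh.1)) (fun x _ => (dec2 m x.2, dec2 m x.1)) ?_ ?_ ?_ ?_ ?_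
  · intro gh _
    rw [mem_product, mem_range, mem_range]
    exact ⟨enc2_lt _, enc2_lt _⟩
  · intro x _; exact mem_univ _
  · intro gh _
    simp only [dec2_enc2]
  · intro x hx
    rw [mem_product, mem_range, mem_range] at hx
    simp only [enc2_dec2 hx.1, enc2_dec2 hx.2]
  · intro gh _
    obtain ⟨g, h⟩ := gh
    dsimp only
    rw [key_eq_kOf g h]
    by_cases hk : key (enc2 h, enc2 g) = (S2, S1)
    · have hk' := hk
      unfold key at hk'
      simp only [Prod.mk.injEq] at hk'
      rw [if_pos hk, hk'.1, hk'.2, if_pos rfl, mul_comm]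
    · rw [if_neg hk, if_neg]
      intro heq
      apply hk
      have := kOf_inj (and_lt_two_pow (enc2_lt h)) (xor_lt_two_pow (enc2_lt h) (enc2_lt g))
        (key_disjoint (enc2 h, enc2 g)) hS2 hS1 hd heq
      unfold key
      exact Prod.ext this.1 this.2

/-- Additivity of `fib` in the integrand. [this work] -/
theorem fib_sum_sub (m : ℕ) {ι : Type*} (s : Finset ι) (F : ι → ℕ → ℕ → ℤ) (H : ℕ → ℕ → ℤ) (S2 S1 : ℕ) :
    fib m (fun c1 c2 => (∑ p ∈ s, F p c1 c2) - H c1 c2) S2 S1 = (∑ p ∈ s, fib m (F p) S2 S1) - fib m H S2 S1 := by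
  unfold fib
  rw [Finset.sum_sub_distrib, Finset.sum_comm]

/-! ## The Kronecker check -/

/-- THE KRONECKER CHECK for mask-indexed list tables (all of length `2^m`): targets `tL` (`K` integer tables), hypothesis `hL`,
multipliers `aL` (`K` tables of naturals), `bL`; base `2^s`.  Same arithmetic as `OneCutCert.boxCheck` without the box transform. [this work] -/
def twoCopyKronCheck (m K s : ℕ) (tL : List (List ℤ)) (hL : List ℤ) (aL : List (List ℕ)) (bL : List ℕ) : Bool :=
  let Z : ℤ := (List.ofFn fun p : Fin K => (krN s m (aL.getD p []) : ℤ) * krZ s m (tL.getD p [])).sum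
    - (krN s m bL : ℤ) * krZ s m hL
  let off : ℤ := 2 ^ (s - 1) * (((2 : ℤ) ^ (s * 3 ^ m) - 1) / (2 ^ s - 1))
  let bnd : ℕ := 2 ^ m * ((List.ofFn fun p : Fin K => maxNat (aL.getD p []) * maxAbs (tL.getD p [])).sum
    + maxNat bL * maxAbs hL)
  decide (0 < s) && decide (tL.length = K) && (tL.all fun l => l.length = 2 ^ m) && decide (hL.length = 2 ^ m)
    && decide (aL.length = K) && (aL.all fun l => l.length = 2 ^ m) && decide (bL.length = 2 ^ m)
    && decide (bnd < 2 ^ (s - 1))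
    && decide (0 ≤ Z + off) && decide (((Z + off).toNat &&& off.toNat) = off.toNat)

/-- `getD` of a cast list. [folklore] -/
theorem getD_map_natCast (l : List ℕ) (i : ℕ) : (l.map ((↑) : ℕ → ℤ)).getD i 0 = ((l.getD i 0 : ℕ) : ℤ) := by
  rw [List.getD_eq_getElem?_getD, List.getD_eq_getElem?_getD, List.getElem?_map]
  cases l[i]? <;> simp

/-- **Soundness of the Kronecker check**: if it passes, every fibre coefficient of the certificate read from the list tables is
nonnegative, i.e. `twoCopyCheck` passes. [this work] -/
theorem twoCopyCheck_of_kronCheck {m K s : ℕ} {tL : List (List ℤ)} {hL : List ℤ} {aL : List (List ℕ)} {bL : List ℕ}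
    (hc : twoCopyKronCheck m K s tL hL aL bL = true) :
    twoCopyCheck m K (fun p c => (tL.getD p []).getD c 0) (fun c => hL.getD c 0)
      (fun p c => (aL.getD p []).getD c 0) (fun c => bL.getD c 0) = true := by
  unfold twoCopyKronCheck at hc
  simp only [Bool.and_eq_true, decide_eq_true_eq, List.all_eq_true] at hc
  obtain ⟨⟨⟨⟨⟨⟨⟨⟨⟨hs, htlen⟩, htall⟩, hhlen⟩, halen⟩, haall⟩, hblen⟩, hbnd⟩, hZoff⟩, hland⟩ := hc
  -- the corner tables
  let Λ : Fin K → (Fin m → Bool) → ℤ := fun p => tabOf ((aL.getD p []).map ((↑) : ℕ → ℤ))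
  let T : Fin K → (Fin m → Bool) → ℤ := fun p => tabOf (tL.getD p [])
  let C : (Fin m → Bool) → ℤ := tabOf (bL.map ((↑) : ℕ → ℤ))
  let H : (Fin m → Bool) → ℤ := tabOf hL
  have htl : ∀ p : Fin K, (tL.getD p []).length = 2 ^ m := fun p => by
    have hp : (p : ℕ) < tL.length := by rw [htlen]; exact p.2
    rw [List.getD_eq_getElem?_getD, List.getElem?_eq_getElem hp, Option.getD_some]
    exact htall _ (List.getElem_mem hp)
  have hal : ∀ p : Fin K, (aL.getD p []).length = 2 ^ m := fun p => by
    have hp : (p : ℕ) < aL.length := by rw [halen]; exact p.2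
    rw [List.getD_eq_getElem?_getD, List.getElem?_eq_getElem hp, Option.getD_some]
    exact haall _ (List.getElem_mem hp)
  -- Step A (verbatim from `OneCutCert.boxCheck_sound`): all corner fibre sums are nonnegative
  have hmaxNat : ∀ l : List ℕ, (maxAbs (l.map ((↑) : ℕ → ℤ)) : ℤ) = (maxNat l : ℤ) := fun l => by
    rw [maxAbs_map_natCast]; rfl
  have hA : ∀ k, 0 ≤ certCoefZ Λ T C H k := by
    have hoff : ((2 : ℤ) ^ (s - 1) * ((2 ^ (s * 3 ^ m) - 1) / (2 ^ s - 1))) = (maskN s (3 ^ m) : ℤ) := by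
      rw [off_eq s _ hs, Finset.mul_sum, maskN_eq_sum s hs]
    rw [hoff, Int.toNat_natCast] at hland
    rw [hoff] at hZoff
    refine certCoefZ_nonneg_of_digit_ge hs ?_ ((_ : ℤ) + _).toNat ?_
      (fun j hj => digit_ge_of_land s hs (3 ^ m) _ hland j hj)
    · intro k
      have h1 : |certCoefZ Λ T C H k| ≤
          ∑ q : Fin K, 2 ^ m * ((maxAbs ((aL.getD q []).map ((↑) : ℕ → ℤ)) : ℤ) * maxAbs (tL.getD q [])) +
            2 ^ m * ((maxAbs (bL.map ((↑) : ℕ → ℤ)) : ℤ) * maxAbs hL) := by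
        unfold certCoefZ
        refine (abs_sub _ _).trans (add_le_add ((Finset.abs_sum_le_sum_abs _ _).trans
          (Finset.sum_le_sum fun q _ => abs_pcoef_le _ _ k)) (abs_pcoef_le _ _ k))
      have h2 : (∑ q : Fin K, 2 ^ m * ((maxAbs ((aL.getD q []).map ((↑) : ℕ → ℤ)) : ℤ) * maxAbs (tL.getD q [])) +
            2 ^ m * ((maxAbs (bL.map ((↑) : ℕ → ℤ)) : ℤ) * maxAbs hL) : ℤ) =
          ((2 ^ m * ((List.ofFn fun k : Fin K => maxNat (aL.getD k []) * maxAbs (tL.getD k [])).sum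
            + maxNat bL * maxAbs hL) : ℕ) : ℤ) := by
        rw [List.sum_ofFn]
        push_cast
        simp only [hmaxNat, mul_add, Finset.mul_sum]
      rw [h2] at h1
      exact lt_of_le_of_lt h1 (by exact_mod_cast hbnd)
    · rw [Int.toNat_of_nonneg hZoff]
      congr 1
      · unfold certZ
        rw [List.sum_ofFn]
        congr 1
        · refine Finset.sum_congr rfl fun k _ => ?_
          rw [krN_eq s m _ (hal k), krZ_eq s _ (htl k)]
        · rw [krN_eq s m _ hblen, krZ_eq s _ hhlen]
      · rw [maskN_eq_sum s hs, Finset.sum_range]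
  -- Step B: the mask fibre sums are the corner fibre sums
  unfold twoCopyCheck
  simp only [List.all_eq_true, List.mem_range, Bool.or_eq_true, bne_iff_ne, ne_eq, decide_eq_true_eq]
  intro S1 hS1 S2 hS2
  by_cases hd : S2 &&& S1 = 0
  · right
    have hfib : fib m (pairing K (fun p c => (tL.getD p []).getD c 0) (fun c => hL.getD c 0)
        (fun p c => (aL.getD p []).getD c 0) (fun c => bL.getD c 0)) S2 S1 = certCoefZ Λ T C H (kOf m S2 S1) := by
      unfold pairing certCoefZ
      rw [fib_sum_sub, Finset.sum_range]
      congr 1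
      · refine Finset.sum_congr rfl fun p _ => ?_
        rw [show (fun c1 c2 => (tL.getD (p : ℕ) []).getD c1 0 * (((aL.getD (p : ℕ) []).getD c2 0 : ℕ) : ℤ)) =
            fun c1 c2 => (tL.getD (p : ℕ) []).getD c1 0 * ((aL.getD (p : ℕ) []).map ((↑) : ℕ → ℤ)).getD c2 0 from by
              funext c1 c2; rw [getD_map_natCast]]
        exact (pcoef_enc2_eq_fib m _ _ hS2 hS1 hd).symm
      · rw [show (fun c1 c2 => hL.getD c1 0 * ((bL.getD c2 0 : ℕ) : ℤ)) =
            fun c1 c2 => hL.getD c1 0 * (bL.map ((↑) : ℕ → ℤ)).getD c2 0 from by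
              funext c1 c2; rw [getD_map_natCast]]
        exact (pcoef_enc2_eq_fib m _ _ hS2 hS1 hd).symm
    rw [hfib]
    exact hA _
  · left; exact hd

end Summit.CriticalPhenomena.PercolationContinuityZ3.Theorems.TwoCopy
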